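import Summits.QuantumFields.QCD.Theorems.QuarksAsStableActionCriticalLineDiamagnetismStubFrequencyDiamagnetismAux1
import Summits.QuantumFields.QCD.Theorems.QuarksAsStableActionStableActionBridgeWilsonTransferForm
import Summits.QuantumFields.QCD.Theorems.QuarksAsStableActionStableActionBridgeTimeSlice

/-!
# Stub `stub_frequencyDiamagnetism` of line `Sketch` — auxiliary file 2: the time form of the 2D frequency operator
as a Wilson-type projector chain
(crux `Summit.QuantumFields.QCD.Theses.QuarksAsStableAction.CriticalLineDiamagnetism`, item stmt-QuantumFields-9734,
static route for odd tori)

Ordering the sites of the two-torus by the first coordinate `t` ("time"), the time form `tfreqOp A m ω₀ ω₁` of the 2D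
frequency operator (auxiliary file 1) is the projector chain of `det_projChain` (p-chain of crux 9737) on the slice
space `k = ℤ/L × colour × spin`: same-time blocks `A_t = B_t ⊗ 1 + Σ_j C_{t,j} ⊗ γ_{j+1}` (`sliceOp`) with the
SPIN-BLIND part `B_t = M_ω·1 − ½(H_t + H_tᴴ)` (`massHop`; `M_ω = m + 4 − cos ω₀ − cos ω₁`, `H_t` the seam-signed gauge
hop along the second coordinate, `hop3`) and the anti-Hermitian coefficients `C_t = (i sin ω₁·1, i sin ω₀·1, ½(H_t − H_tᴴ))`
(`hopCoeff`), forward hop `−P⁻W_t` and backward hop `−P⁺W′_t` with the seam-signed temporal transporters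
`W_t = σ_t A(t,·,2) ⊗ 1`, `W′_t = σ_t A(t,·,2)ᴴ ⊗ 1` (`link2`, `link2'`) and the Wilson time projections `P± = ½(1 ± γ₀)`
(`projP`, `projM`) — `tfreqOp_submatrix_timeSlice`.  The slice data satisfy the nine commutation claims of
`wilsonSlice_spin_structure` (`slice_spin_structure`, from `SliceSpin.kronecker_claims`) and the five positivity claims
of `WilsonTransfer.slice_claims` (`slice_claims`, from `WilsonTransfer.kronecker_claims_plus`): `B_t > 0` for `m > −1`
since the hop is an isometry and `M_ω ≥ m + 2 > 1` (`massHop_posDef`).  Hence the time-slice reduction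
`tfreqOp_det_slice_reduction` (`det_projChain`) and, by the explicit chain-block inverse, the dressed one-step matrices,
their positivity and the cyclic undressing (p119771, p120153, p119842, p119981 of crux 9737), LÜSCHER'S TRANSFER-MATRIX
FORM `det tfreqOp = (∏_t det E_t) · det(1 − ∏_{t<L} M_t W_t)`, `M_t > 0` (`tfreqOp_det_transfer_form`; registered as
`stub_frequencyDiamagnetismAux2`).  References: M. Lüscher, Commun. Math. Phys. 54 (1977) 283; J. Smit, *Introduction to
Quantum Fields on a Lattice*, §6.5.
-/

noncomputable section

open scoped BigOperators Matrix ComplexConjugate Kronecker ComplexOrder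
open Finset
open Literature.MathematicalPhysics.QuantumLattice Literature.MathematicalPhysics.QuantumFieldTheory
  Literature.Probability.LatticeModels

namespace Summit.QuantumFields.QCD.Cruxes.CriticalLineDiamagnetism.ChessboardCellGain

namespace FrequencyDiamagnetism

open Matrix Complex
open Summit.QuantumFields.QCD.Cruxes.StableActionBridge.Sketch

/-! ### The time form is the projector chain of its slice data -/

/-- The star of a seam sign is itself. -/
theorem star_seamSign (P : Prop) [Decidable P] : star (if P then (-1 : ℂ) else 1) = if P then (-1 : ℂ) else 1 := by
  split_ifs <;> simp

/-- Entries of the slice operator. -/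
theorem sliceOp_apply {L : ℕ} [NeZero L] (A : ZMod L → ZMod L → Fin 4 → Matrix.unitaryGroup (Fin 3) ℂ)
    (m ω₀ ω₁ : ℝ) (t : ZMod L) (a b : ZMod L × Fin 3 × Fin 4) :
    sliceOp A m ω₀ ω₁ t a b =
      (if a.1 = b.1 ∧ a.2.1 = b.2.1 then
          (((m + 4 - Real.cos ω₀ - Real.cos ω₁ : ℝ) : ℂ) * (1 : Matrix (Fin 4) (Fin 4) ℂ) a.2.2 b.2.2 +
            Complex.I * (((Real.sin ω₀ : ℝ) : ℂ) * euclideanGamma 2 a.2.2 b.2.2 +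
              ((Real.sin ω₁ : ℝ) : ℂ) * euclideanGamma 1 a.2.2 b.2.2))
        else 0) -
        (1 / 2 : ℂ) *
          ((if b.1 = a.1 + 1 then
              ((1 : Matrix (Fin 4) (Fin 4) ℂ) - euclideanGamma 3) a.2.2 b.2.2 *
                ((if a.1 = -1 then (-1 : ℂ) else 1) * (A t a.1 3 : Matrix (Fin 3) (Fin 3) ℂ) a.2.1 b.2.1)
            else 0) +
           (if a.1 = b.1 + 1 then
              ((1 : Matrix (Fin 4) (Fin 4) ℂ) + euclideanGamma 3) a.2.2 b.2.2 *
                ((if b.1 = -1 then (-1 : ℂ) else 1) * (star (A t b.1 3 : Matrix (Fin 3) (Fin 3) ℂ)) a.2.1 b.2.1)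
            else 0)) := by
  obtain ⟨x, c, α⟩ := a
  obtain ⟨y, d, β⟩ := b
  rw [sliceOp, map_add, map_sum, Matrix.add_apply, Matrix.sum_apply]
  simp only [SliceSpin.reindex_kronecker_apply, Fin.sum_univ_three, hopCoeff, massHop, hop3, Matrix.cons_val_zero,
    Matrix.cons_val_one, Matrix.cons_val_two, Matrix.head_cons, Matrix.tail_cons, Fin.succ_zero_eq_one,
    Fin.succ_one_eq_two, Matrix.sub_apply, Matrix.add_apply, Matrix.smul_apply, Matrix.diagonal_apply,
    Matrix.conjTranspose_apply, Matrix.of_apply, Matrix.one_apply, Matrix.star_apply, smul_eq_mul, star_mul',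
    Prod.mk.injEq, apply_ite (star : ℂ → ℂ), star_zero, star_neg, star_one]
  have h3 : (Fin.succ (2 : Fin 3)) = 3 := rfl
  simp only [h3]
  split_ifs <;> ring

/-- **Time-slicing of the time form.**  Reindexing the two-torus site by (first coordinate, rest), the time form
`tfreqOp A m ω₀ ω₁` is the projector chain with same-time blocks `sliceOp A m ω₀ ω₁ t`, forward temporal hop
`−P⁻ W_t` to row `t + 1` and backward hop `−P⁺ W′_s` from row `s + 1` to row `s` (valid for every `L ≥ 1`; the three
cases are kept as separate summands, they overlap when `L ≤ 2`). -/
theorem tfreqOp_submatrix_timeSlice {L : ℕ} [NeZero L] (A : ZMod L → ZMod L → Fin 4 → Matrix.unitaryGroup (Fin 3) ℂ)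
    (m ω₀ ω₁ : ℝ) :
    (tfreqOp A m ω₀ ω₁).submatrix (fun p : ZMod L × (ZMod L × Fin 3 × Fin 4) => ((p.1, p.2.1), p.2.2))
        (fun p : ZMod L × (ZMod L × Fin 3 × Fin 4) => ((p.1, p.2.1), p.2.2)) =
      Matrix.of fun p q : ZMod L × (ZMod L × Fin 3 × Fin 4) =>
        (if q.1 = p.1 then sliceOp A m ω₀ ω₁ p.1 p.2 q.2 else 0) -
          (if q.1 = p.1 + 1 then (projM L * link2 A p.1) p.2 q.2 else 0) -
          (if p.1 = q.1 + 1 then (projP L * link2' A q.1) p.2 q.2 else 0) := by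
  have hsw0 : Equiv.swap (0 : Fin 4) 2 0 = 2 := by decide
  have hsw1 : Equiv.swap (0 : Fin 4) 2 1 = 1 := by decide
  have hsw2 : Equiv.swap (0 : Fin 4) 2 2 = 0 := by decide
  have hsw3 : Equiv.swap (0 : Fin 4) 2 3 = 3 := by decide
  have hPmW : ∀ t, projM L * link2 A t = Matrix.of fun a b : ZMod L × Fin 3 × Fin 4 => if a.1 = b.1 then
      ((1 / 2 : ℂ) • (1 - euclideanGamma 0)) a.2.2 b.2.2 *
        ((if t = -1 then (-1 : ℂ) else 1) • (A t a.1 2 : Matrix (Fin 3) (Fin 3) ℂ)) a.2.1 b.2.1 else 0 := fun t =>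
    TimeSlice.spinLift_mul_colourLift _ (fun x => (if t = -1 then (-1 : ℂ) else 1) • (A t x 2 : Matrix (Fin 3) (Fin 3) ℂ))
  have hPpW' : ∀ t, projP L * link2' A t = Matrix.of fun a b : ZMod L × Fin 3 × Fin 4 => if a.1 = b.1 then
      ((1 / 2 : ℂ) • (1 + euclideanGamma 0)) a.2.2 b.2.2 *
        ((if t = -1 then (-1 : ℂ) else 1) • (star (A t a.1 2 : Matrix (Fin 3) (Fin 3) ℂ))) a.2.1 b.2.1 else 0 :=
    fun t => TimeSlice.spinLift_mul_colourLift _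
      (fun x => (if t = -1 then (-1 : ℂ) else 1) • (star (A t x 2 : Matrix (Fin 3) (Fin 3) ℂ)))
  ext ⟨t, x, c, α⟩ ⟨s, y, d, β⟩
  simp only [Matrix.submatrix_apply, Matrix.of_apply, hPmW, hPpW', sliceOp_apply]
  simp only [tfreqOp, freqOp, Matrix.of_apply, hsw0, hsw1, hsw2, hsw3, Prod.mk.injEq, Matrix.smul_apply, smul_eq_mul]
  by_cases hst : s = t
  · subst hst
    by_cases hxy : y = x
    · subst hxy
      simp only [true_and, and_true, and_self, if_true]
      split_ifs <;> ring
    · simp only [hxy, Ne.symm hxy, true_and, false_and, and_false, if_true, if_false]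
      split_ifs <;> ring
  · by_cases hxy : y = x
    · subst hxy
      simp only [hst, Ne.symm hst, true_and, and_true, false_and, if_true, if_false]
      split_ifs <;> ring
    · simp only [hst, Ne.symm hst, hxy, Ne.symm hxy, false_and, and_false, if_false]
      split_ifs <;> ring

/-! ### The spin structure of the slice data -/

/-- Kronecker form of `P⁺`. -/
theorem projP_eq (L : ℕ) [NeZero L] : projP L = Matrix.reindexAlgEquiv ℂ ℂ (Equiv.prodAssoc (ZMod L) (Fin 3) (Fin 4))
    ((1 : Matrix (ZMod L × Fin 3) (ZMod L × Fin 3) ℂ) ⊗ₖ ((1 / 2 : ℂ) • (1 + euclideanGamma 0))) :=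
  SliceSpin.of_spin_eq _

/-- Kronecker form of `P⁻`. -/
theorem projM_eq (L : ℕ) [NeZero L] : projM L = Matrix.reindexAlgEquiv ℂ ℂ (Equiv.prodAssoc (ZMod L) (Fin 3) (Fin 4))
    ((1 : Matrix (ZMod L × Fin 3) (ZMod L × Fin 3) ℂ) ⊗ₖ ((1 / 2 : ℂ) • (1 - euclideanGamma 0))) :=
  SliceSpin.of_spin_eq _

/-- Kronecker form of the forward temporal transporter. -/
theorem link2_eq {L : ℕ} [NeZero L] (A : ZMod L → ZMod L → Fin 4 → Matrix.unitaryGroup (Fin 3) ℂ) (t : ZMod L) :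
    link2 A t = Matrix.reindexAlgEquiv ℂ ℂ (Equiv.prodAssoc (ZMod L) (Fin 3) (Fin 4))
      ((Matrix.of fun p q : ZMod L × Fin 3 => if p.1 = q.1 then
          ((if t = -1 then (-1 : ℂ) else 1) • (A t p.1 2 : Matrix (Fin 3) (Fin 3) ℂ)) p.2 q.2 else 0) ⊗ₖ
        (1 : Matrix (Fin 4) (Fin 4) ℂ)) :=
  SliceSpin.of_colour_eq fun x => (if t = -1 then (-1 : ℂ) else 1) • (A t x 2 : Matrix (Fin 3) (Fin 3) ℂ)

/-- Kronecker form of the backward temporal transporter. -/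
theorem link2'_eq {L : ℕ} [NeZero L] (A : ZMod L → ZMod L → Fin 4 → Matrix.unitaryGroup (Fin 3) ℂ) (t : ZMod L) :
    link2' A t = Matrix.reindexAlgEquiv ℂ ℂ (Equiv.prodAssoc (ZMod L) (Fin 3) (Fin 4))
      ((Matrix.of fun p q : ZMod L × Fin 3 => if p.1 = q.1 then
          ((if t = -1 then (-1 : ℂ) else 1) • (star (A t p.1 2 : Matrix (Fin 3) (Fin 3) ℂ))) p.2 q.2 else 0) ⊗ₖ
        (1 : Matrix (Fin 4) (Fin 4) ℂ)) :=
  SliceSpin.of_colour_eq fun x => (if t = -1 then (-1 : ℂ) else 1) • (star (A t x 2 : Matrix (Fin 3) (Fin 3) ℂ))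

/-- The seam-signed temporal links are unitary: `(σ_t A⁻¹)(σ_t A) = 1` colour block by colour block. -/
theorem signedLink_inv_mul {L : ℕ} (A : ZMod L → ZMod L → Fin 4 → Matrix.unitaryGroup (Fin 3) ℂ) (t x : ZMod L) :
    (if t = -1 then (-1 : ℂ) else 1) • (star (A t x 2 : Matrix (Fin 3) (Fin 3) ℂ)) *
        ((if t = -1 then (-1 : ℂ) else 1) • (A t x 2 : Matrix (Fin 3) (Fin 3) ℂ)) = 1 := by
  have hU : star (A t x 2 : Matrix (Fin 3) (Fin 3) ℂ) * (A t x 2 : Matrix (Fin 3) (Fin 3) ℂ) = 1 :=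
    Matrix.mem_unitaryGroup_iff'.mp (A t x 2).2
  by_cases ht : t = -1 <;> simp [ht, hU]

/-- **The nine commutation claims** of `wilsonSlice_spin_structure` for the slice data of the time form:
`P⁻A_tP⁻ = B̂_tP⁻`, `B̂_t` commutes with `P±`, `det B̂_t = (det B_t)⁴`, `W_t`, `W′_t` commute with `P±`, `W′_tW_t = 1`. -/
theorem slice_spin_structure {L : ℕ} [NeZero L] (A : ZMod L → ZMod L → Fin 4 → Matrix.unitaryGroup (Fin 3) ℂ)
    (m ω₀ ω₁ : ℝ) (t : ZMod L) :
    projM L * sliceOp A m ω₀ ω₁ t * projM L = sliceBh A m ω₀ ω₁ t * projM L ∧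
      sliceBh A m ω₀ ω₁ t * projM L = projM L * sliceBh A m ω₀ ω₁ t ∧
      sliceBh A m ω₀ ω₁ t * projP L = projP L * sliceBh A m ω₀ ω₁ t ∧
      (sliceBh A m ω₀ ω₁ t).det = (massHop A m ω₀ ω₁ t).det ^ 4 ∧
      link2 A t * projP L = projP L * link2 A t ∧ link2 A t * projM L = projM L * link2 A t ∧
      link2' A t * projP L = projP L * link2' A t ∧ link2' A t * projM L = projM L * link2' A t ∧
      link2' A t * link2 A t = 1 := by
  have h := SliceSpin.kronecker_claims (massHop A m ω₀ ω₁ t)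
    (Matrix.of fun p q : ZMod L × Fin 3 => if p.1 = q.1 then
      ((if t = -1 then (-1 : ℂ) else 1) • (A t p.1 2 : Matrix (Fin 3) (Fin 3) ℂ)) p.2 q.2 else 0)
    (Matrix.of fun p q : ZMod L × Fin 3 => if p.1 = q.1 then
      ((if t = -1 then (-1 : ℂ) else 1) • (star (A t p.1 2 : Matrix (Fin 3) (Fin 3) ℂ))) p.2 q.2 else 0)
    (hopCoeff A ω₀ ω₁ t)
    (SliceSpin.of_colour_mul_of_colour_eq_one
      (fun x => (if t = -1 then (-1 : ℂ) else 1) • (star (A t x 2 : Matrix (Fin 3) (Fin 3) ℂ)))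
      (fun x => (if t = -1 then (-1 : ℂ) else 1) • (A t x 2 : Matrix (Fin 3) (Fin 3) ℂ)) (signedLink_inv_mul A t))
  rw [projP_eq, projM_eq, link2_eq, link2'_eq]
  unfold sliceOp sliceBh
  exact h

/-- The hop along the second coordinate is an isometry: `H_tᴴ H_t = 1`. -/
theorem conjTranspose_mul_hop3 {L : ℕ} [NeZero L] (A : ZMod L → ZMod L → Fin 4 → Matrix.unitaryGroup (Fin 3) ℂ)
    (t : ZMod L) : (hop3 A t)ᴴ * hop3 A t = 1 := by
  refine SliceMassHop.conjTranspose_mul_blockPermHop (fun x : ZMod L => x + 1) (add_left_injective 1)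
    (fun x => (if x = -1 then (-1 : ℂ) else 1) • (A t x 3 : Matrix (Fin 3) (Fin 3) ℂ)) fun y => ?_
  have hU : (A t y 3 : Matrix (Fin 3) (Fin 3) ℂ) * (A t y 3 : Matrix (Fin 3) (Fin 3) ℂ)ᴴ = 1 := by
    simpa only [Matrix.star_eq_conjTranspose] using Matrix.mem_unitaryGroup_iff.mp (A t y 3).2
  split_ifs <;> simp [hU]

/-- **Positivity of the spin-blind slice operator** `B_t = M_ω·1 − ½(H_t + H_tᴴ)` for `m > −1`: the hop is an
isometry and `M_ω = m + 4 − cos ω₀ − cos ω₁ > 1` (`SliceMassHopPosDef.posDef_diagonal_sub_hopSum`). -/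
theorem massHop_posDef {L : ℕ} [NeZero L] (A : ZMod L → ZMod L → Fin 4 → Matrix.unitaryGroup (Fin 3) ℂ) {m : ℝ}
    (hm : -1 < m) (ω₀ ω₁ : ℝ) (t : ZMod L) : (massHop A m ω₀ ω₁ t).PosDef := by
  have h := SliceMassHopPosDef.posDef_diagonal_sub_hopSum (fun _ : Fin 1 => hop3 A t)
    (fun _ => conjTranspose_mul_hop3 A t) (fun _ : ZMod L × Fin 3 => m + 4 - Real.cos ω₀ - Real.cos ω₁)
    (fun _ => by
      rw [Fintype.card_fin]
      push_cast
      linarith [Real.cos_le_one ω₀, Real.cos_le_one ω₁])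
  rw [Fin.sum_univ_one] at h
  exact h

/-- The coefficients `C_{t,j}` are anti-Hermitian. -/
theorem hopCoeff_conjTranspose {L : ℕ} [NeZero L] (A : ZMod L → ZMod L → Fin 4 → Matrix.unitaryGroup (Fin 3) ℂ)
    (ω₀ ω₁ : ℝ) (t : ZMod L) : ∀ j, (hopCoeff A ω₀ ω₁ t j)ᴴ = -hopCoeff A ω₀ ω₁ t j := by
  intro j
  fin_cases j
  · show ((Complex.I * ((Real.sin ω₁ : ℝ) : ℂ)) • (1 : Matrix (ZMod L × Fin 3) (ZMod L × Fin 3) ℂ))ᴴ = _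
    rw [conjTranspose_smul, conjTranspose_one]
    show _ = -((Complex.I * ((Real.sin ω₁ : ℝ) : ℂ)) • (1 : Matrix (ZMod L × Fin 3) (ZMod L × Fin 3) ℂ))
    rw [← neg_smul, star_mul', Complex.star_def, Complex.conj_I, Complex.conj_ofReal, neg_mul]
  · show ((Complex.I * ((Real.sin ω₀ : ℝ) : ℂ)) • (1 : Matrix (ZMod L × Fin 3) (ZMod L × Fin 3) ℂ))ᴴ = _
    rw [conjTranspose_smul, conjTranspose_one]
    show _ = -((Complex.I * ((Real.sin ω₀ : ℝ) : ℂ)) • (1 : Matrix (ZMod L × Fin 3) (ZMod L × Fin 3) ℂ))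
    rw [← neg_smul, star_mul', Complex.star_def, Complex.conj_I, Complex.conj_ofReal, neg_mul]
  · show ((1 / 2 : ℂ) • (hop3 A t - (hop3 A t)ᴴ))ᴴ = -((1 / 2 : ℂ) • (hop3 A t - (hop3 A t)ᴴ))
    rw [conjTranspose_smul, conjTranspose_sub, conjTranspose_conjTranspose, TimeKernelPosDef.star_one_half, ← smul_neg,
      neg_sub]

/-- **The five positivity claims** of `WilsonTransfer.slice_claims` for the slice data of the time form (`m > −1`):
`P⁺A_tP⁺ = B̂_tP⁺`, `(A_t − B̂_t)ᴴ = −(A_t − B̂_t)`, `P±ᴴ = P±`, `B̂_t > 0`. -/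
theorem slice_claims {L : ℕ} [NeZero L] (A : ZMod L → ZMod L → Fin 4 → Matrix.unitaryGroup (Fin 3) ℂ) {m : ℝ}
    (hm : -1 < m) (ω₀ ω₁ : ℝ) (t : ZMod L) :
    projP L * sliceOp A m ω₀ ω₁ t * projP L = sliceBh A m ω₀ ω₁ t * projP L ∧
      (sliceOp A m ω₀ ω₁ t - sliceBh A m ω₀ ω₁ t)ᴴ = -(sliceOp A m ω₀ ω₁ t - sliceBh A m ω₀ ω₁ t) ∧
      (projP L)ᴴ = projP L ∧ (projM L)ᴴ = projM L ∧ (sliceBh A m ω₀ ω₁ t).PosDef := by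
  rw [projP_eq, projM_eq]
  exact WilsonTransfer.kronecker_claims_plus (massHop A m ω₀ ω₁ t) (hopCoeff A ω₀ ω₁ t)
    (hopCoeff_conjTranspose A ω₀ ω₁ t) (massHop_posDef A hm ω₀ ω₁ t)

/-- `det B̂_t` is a unit for `m > −1`. -/
theorem isUnit_det_sliceBh {L : ℕ} [NeZero L] (A : ZMod L → ZMod L → Fin 4 → Matrix.unitaryGroup (Fin 3) ℂ) {m : ℝ}
    (hm : -1 < m) (ω₀ ω₁ : ℝ) (t : ZMod L) : IsUnit (sliceBh A m ω₀ ω₁ t).det := by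
  rw [(slice_spin_structure A m ω₀ ω₁ t).2.2.2.1]
  exact ((Matrix.isUnit_iff_isUnit_det _).mp (massHop_posDef A hm ω₀ ω₁ t).isUnit).pow 4

/-! ### The time-slice reduction of the frequency determinant -/

/-- **Time-slice reduction** of the 2D frequency determinant (`det_projChain` applied to the time form):
`det tfreqOp = (∏_t det E_t) · det(1 − (−1)^L ∏_{t<L} E_t⁻¹ F_t)` with `E_t = A_tP⁻ − P⁺W′_{t−1}`, `F_t = A_tP⁺ − P⁻W_t`. -/
theorem tfreqOp_det_slice_reduction {L : ℕ} [NeZero L] (A : ZMod L → ZMod L → Fin 4 → Matrix.unitaryGroup (Fin 3) ℂ)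
    {m : ℝ} (hm : -1 < m) (ω₀ ω₁ : ℝ) :
    (tfreqOp A m ω₀ ω₁).det =
      (∏ t : ZMod L, (sliceOp A m ω₀ ω₁ t * projM L - projP L * link2' A (t - 1)).det) *
        (1 - (-1 : ℂ) ^ L •
          ((List.range L).map fun i : ℕ =>
            (sliceOp A m ω₀ ω₁ (i : ZMod L) * projM L - projP L * link2' A ((i : ZMod L) - 1))⁻¹ *
              (sliceOp A m ω₀ ω₁ (i : ZMod L) * projP L - projM L * link2 A (i : ZMod L))).prod).det := by
  have hspin := fun t : ZMod L => slice_spin_structure A m ω₀ ω₁ t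
  have hchain := det_projChain L (ZMod L) 3 (sliceOp A m ω₀ ω₁) (link2 A) (link2' A)
    (fun t => (hspin t).2.2.2.2.1) (fun t => (hspin t).2.2.2.2.2.1)
    (fun t => (hspin t).2.2.2.2.2.2.1) (fun t => (hspin t).2.2.2.2.2.2.2.1)
    (fun t => by
      obtain ⟨-, -, -, -, -, -, hW'p, -, hW'W⟩ := hspin (t - 1)
      obtain ⟨hPAP', hBP', -, -, -, -, -, -, -⟩ := hspin t
      exact isUnit_det_projChainBlock (ZMod L × Fin 3 × Fin 4) (sliceOp A m ω₀ ω₁ t) _ (link2' A (t - 1)) (projP L)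
        (projM L) (liftProjPlus_add_liftProjMinus (ZMod L) 3) (liftProjPlus_mul_liftProjMinus (ZMod L) 3)
        (liftProjMinus_mul_liftProjPlus (ZMod L) 3) hPAP' hBP' (isUnit_det_sliceBh A hm ω₀ ω₁ t) hW'p
        (Matrix.isUnit_det_of_right_inverse hW'W))
  have hdet : (tfreqOp A m ω₀ ω₁).det =
      ((tfreqOp A m ω₀ ω₁).submatrix (fun p : ZMod L × (ZMod L × Fin 3 × Fin 4) => ((p.1, p.2.1), p.2.2))
        (fun p : ZMod L × (ZMod L × Fin 3 × Fin 4) => ((p.1, p.2.1), p.2.2))).det :=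
    (Matrix.det_submatrix_equiv_self (Equiv.prodAssoc (ZMod L) (ZMod L) (Fin 3 × Fin 4)).symm _).symm
  rw [hdet, tfreqOp_submatrix_timeSlice]
  exact hchain

/-! ### Lüscher's transfer-matrix form of the frequency determinant -/

/-- **Lüscher's transfer-matrix form of the 2D frequency determinant** (the pipeline of `wilson_det_transfer_form`
run on the time form): for `m > −1`, `det tfreqOp = (∏_t det E_t) · det(1 − ∏_{t<L} M_t W_t)` with every dressed
one-step matrix `M_t = oneStep A m ω₀ ω₁ t` Hermitian positive definite and `W_t = link2 A t` the seam-signed unitary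
temporal transporters. -/
theorem tfreqOp_det_transfer_form {L : ℕ} [NeZero L] (A : ZMod L → ZMod L → Fin 4 → Matrix.unitaryGroup (Fin 3) ℂ)
    {m : ℝ} (hm : -1 < m) (ω₀ ω₁ : ℝ) :
    (tfreqOp A m ω₀ ω₁).det =
        (∏ t : ZMod L, (sliceOp A m ω₀ ω₁ t * projM L - projP L * link2' A (t - 1)).det) *
          (1 - ((List.range L).map fun i : ℕ => oneStep A m ω₀ ω₁ (i : ZMod L) * link2 A (i : ZMod L)).prod).det ∧
      ∀ t : ZMod L, (oneStep A m ω₀ ω₁ t).PosDef := by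
  -- adapted from `wilson_det_transfer_form` (…StableActionBridgeWilsonTransferForm.lean)
  have hP : projP L + projM L = 1 := liftProjPlus_add_liftProjMinus (ZMod L) 3
  have hPQ : projP L * projM L = 0 := liftProjPlus_mul_liftProjMinus (ZMod L) 3
  have hQP : projM L * projP L = 0 := liftProjMinus_mul_liftProjPlus (ZMod L) 3
  have hPP : projP L * projP L = projP L := WilsonTransfer.mul_self_of_add_eq_one hP hPQ
  have hQQ : projM L * projM L = projM L := WilsonTransfer.mul_self_of_add_eq_one ((add_comm _ _).trans hP) hQP
  have hspin := fun t : ZMod L => slice_spin_structure A m ω₀ ω₁ t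
  have hplus := fun t : ZMod L => slice_claims A hm ω₀ ω₁ t
  have hdetBh : ∀ t : ZMod L, IsUnit (sliceBh A m ω₀ ω₁ t).det := fun t => isUnit_det_sliceBh A hm ω₀ ω₁ t
  have hCpp : ∀ t : ZMod L, projP L * (sliceOp A m ω₀ ω₁ t - sliceBh A m ω₀ ω₁ t) * projP L = 0 := fun t =>
    WilsonTransfer.proj_sub_proj_eq_zero (hplus t).1 (hspin t).2.2.1 hPP
  have hCmm : ∀ t : ZMod L, projM L * (sliceOp A m ω₀ ω₁ t - sliceBh A m ω₀ ω₁ t) * projM L = 0 := fun t =>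
    WilsonTransfer.proj_sub_proj_eq_zero (hspin t).1 (hspin t).2.1 hQQ
  -- the explicit inverse of the chain block
  have hEinv : ∀ t : ZMod L, (sliceOp A m ω₀ ω₁ t * projM L - projP L * link2' A (t - 1))⁻¹ =
      -(link2 A (t - 1) * projP L) +
        link2 A (t - 1) * projP L * (sliceOp A m ω₀ ω₁ t - sliceBh A m ω₀ ω₁ t) * (sliceBh A m ω₀ ω₁ t)⁻¹ * projM L +
        (sliceBh A m ω₀ ω₁ t)⁻¹ * projM L := fun t => by
    refine Matrix.inv_eq_right_inv ?_
    have h := projChainBlock_mul_explicitInv _ (projP L) (projM L) (sliceBh A m ω₀ ω₁ t)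
      (sliceOp A m ω₀ ω₁ t - sliceBh A m ω₀ ω₁ t) (link2 A (t - 1)) (link2' A (t - 1)) hP hPP hQQ hPQ hQP
      (hspin t).2.2.1 (hspin t).2.1 (hCmm t) (hspin (t - 1)).2.2.2.2.2.2.1 (hspin (t - 1)).2.2.2.2.2.1
      (hspin (t - 1)).2.2.2.2.2.2.2.2 (hdetBh t)
    rwa [add_sub_cancel] at h
  -- the dressed one-step matrices
  have hstep : ∀ t : ZMod L, (sliceOp A m ω₀ ω₁ t * projM L - projP L * link2' A (t - 1))⁻¹ *
      (sliceOp A m ω₀ ω₁ t * projP L - projM L * link2 A t) =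
      -((link2 A (t - 1) * projP L + projM L) * oneStep A m ω₀ ω₁ t * (projP L + link2 A t * projM L)) := fun t => by
    rw [hEinv t]
    have h := neg_explicitInv_mul_eq_dressed_two _ (projP L) (projM L) (sliceBh A m ω₀ ω₁ t)
      (sliceOp A m ω₀ ω₁ t - sliceBh A m ω₀ ω₁ t) (link2 A (t - 1)) (link2 A t) hPP hQQ hPQ hQP
      (hspin t).2.2.1 (hspin t).2.1 (hCpp t) (hspin t).2.2.2.2.2.1 (hdetBh t)
    rw [add_sub_cancel] at h
    rw [oneStep, ← h, neg_neg]
  -- the product of the one-step matrices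
  have hprod : (-1 : ℂ) ^ L •
      ((List.range L).map fun i : ℕ =>
        (sliceOp A m ω₀ ω₁ (i : ZMod L) * projM L - projP L * link2' A ((i : ZMod L) - 1))⁻¹ *
          (sliceOp A m ω₀ ω₁ (i : ZMod L) * projP L - projM L * link2 A (i : ZMod L))).prod =
      ((List.range L).map fun i : ℕ =>
        (link2 A ((i : ZMod L) - 1) * projP L + projM L) * oneStep A m ω₀ ω₁ i * (projP L + link2 A i * projM L)).prod := by
    have hf : (fun i : ℕ => (sliceOp A m ω₀ ω₁ (i : ZMod L) * projM L - projP L * link2' A ((i : ZMod L) - 1))⁻¹ *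
          (sliceOp A m ω₀ ω₁ (i : ZMod L) * projP L - projM L * link2 A (i : ZMod L))) =
        fun i : ℕ => -((link2 A ((i : ZMod L) - 1) * projP L + projM L) * oneStep A m ω₀ ω₁ i *
          (projP L + link2 A i * projM L)) :=
      funext fun i => hstep i
    rw [hf, WilsonTransfer.prod_map_neg_eq_smul (fun i : ℕ => (link2 A ((i : ZMod L) - 1) * projP L + projM L) *
      oneStep A m ω₀ ω₁ i * (projP L + link2 A i * projM L)) (List.range L), List.length_range, smul_smul, ← mul_pow,
      neg_mul_neg, one_mul, one_pow, one_smul]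
  -- the time-slice reduction and the cyclic undressing
  have hred := tfreqOp_det_slice_reduction A hm ω₀ ω₁
  have hcyc := det_one_sub_smul_prod_dressed _ L 1 (projP L) (projM L) (oneStep A m ω₀ ω₁) (link2 A) hP hPP hQQ hPQ hQP
    (fun t => (hspin t).2.2.2.2.1) (fun t => (hspin t).2.2.2.2.2.1)
  rw [one_smul, one_smul] at hcyc
  refine ⟨?_, fun t => ?_⟩
  · rw [hred, hprod, hcyc]
  · exact dressedCore_posDef _ (projP L) (projM L) (sliceBh A m ω₀ ω₁ t) (sliceOp A m ω₀ ω₁ t - sliceBh A m ω₀ ω₁ t)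
      hP hPP hQQ hPQ hQP (hplus t).2.2.1 (hplus t).2.2.2.1 (hspin t).2.2.1 (hspin t).2.1 (hplus t).2.1 (hplus t).2.2.2.2

end FrequencyDiamagnetism

/-! ### Registered auxiliary theorem -/

/-- **Aux stub `stub_frequencyDiamagnetismAux2`** (Lüscher's transfer-matrix form of the 2D frequency determinant):
for every 2D `U(3)` field `A`, `m > −1` and real frequency pair, the determinant of the time form `tfreqOp A m ω₀ ω₁`
(`= det fD A m ω₀ ω₁` by `det_tfreqOp`) is `(∏_t det E_t) · det(1 − ∏_{t<L} M_t W_t)` with positive definite dressed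
one-step matrices `M_t` and seam-signed unitary temporal transporters `W_t`. -/
theorem stub_frequencyDiamagnetismAux2 : ∀ (L : ℕ) [NeZero L] (A : ZMod L → ZMod L → Fin 4 → Matrix.unitaryGroup (Fin 3) ℂ) (m : ℝ), -1 < m → ∀ ω₀ ω₁ : ℝ, (FrequencyDiamagnetism.tfreqOp A m ω₀ ω₁).det = (∏ t : ZMod L, (FrequencyDiamagnetism.sliceOp A m ω₀ ω₁ t * FrequencyDiamagnetism.projM L - FrequencyDiamagnetism.projP L * FrequencyDiamagnetism.link2' A (t - 1)).det) * (1 - ((List.range L).map fun i : ℕ => FrequencyDiamagnetism.oneStep A m ω₀ ω₁ (i : ZMod L) * FrequencyDiamagnetism.link2 A (i : ZMod L)).prod).det ∧ ∀ t : ZMod L, (FrequencyDiamagnetism.oneStep A m ω₀ ω₁ t).PosDef :=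
  fun _ _ A _ hm ω₀ ω₁ => FrequencyDiamagnetism.tfreqOp_det_transfer_form A hm ω₀ ω₁

end Summit.QuantumFields.QCD.Cruxes.CriticalLineDiamagnetism.ChessboardCellGain

end
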